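import Literature.AlgebraicGeometry.Modules.CechRefineMultiplicative
import Literature.AlgebraicGeometry.Modules.CechUnitModulePairing
import Literature.Algebra.Homology.OrderedCechSystemRefineComp
import Mathlib.Data.Fin.Rev
import HarnessLib

/-!
# The cup product on ordered Čech cohomology is GRADED COMMUTATIVE: `x ⌣ y = (-1)^{pq} y ⌣' x`
# (Serre FAC n° 20; Godement II §6.6; The Stacks Project, Tags 01FG, 01FM, 01FP)

Topic `AlgebraicGeometry/Modules`; namespaces `Literature.Algebra.Homology.OrderedCech(.Full)` (§1–§5, pure algebra) and
`Literature.AlgebraicGeometry.Modules` (§6).  PROOF file (theorems only; no definition, no named fact, no instance, no notation,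
no `sorry`).  Cell `hodgecm-mathlib` FLOOR 0, P1 sub-line F-11, packet (iv)∕J3, brick **(G2)** = `stub_hcomm` of the F-J3b
skeleton (F0P1b-plan (g0) (R100); B-p09 (g18), second hand under F0P1b-p04 (g0)); consumer F-J3b (F0P1b-p02 (g2)): ★ J3
`cup_one_one_surjective`'s binder `hcomm`.  HC_CM is proved only modulo the 7 printed citations until rung 0 closes.

The front∕back (Alexander–Whitney) cup product ★ `OrderedCech.cup β` of ORDERED Čech cochains is not graded commutative on
cochains, only on COHOMOLOGY.  Road (= the Leray-transport pattern of ★ `Modules/CechRefineMultiplicative` (F0P1b-p01 (g0)) with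
the ORDER REVERSAL of the FULL complex in place of an index pull-back `Θ_θ`): on the full complex ★ `Full.complex P` (one component
per arbitrary tuple, cup product BY POSITION ★ `Full.cup`) the reversal of positions `(R c)(α₀,…,α_m) := c(α_m,…,α₀)|` satisfies

* §3 `R ∘ d = (-1)^{m+1} d ∘ R` (`Full.reversal_d`; `rev ∘ δ_j = δ_{rev j} ∘ rev`),
* §2 `R (ext g) = ε_m • ext g` with `ε_m = ∏_{i ≤ m} (-1)^i = (-1)^{m(m+1)/2}` the sign of the reversal (`Full.reversal_ext`; the
  alternating rule ★ `SysCochain.altEvalAt_comp_perm` of `OrderedCechSystemRefineComp`),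
* §4 `R (x ∪_β y) = (R y) ∪_{β'} (R x)` ON THE NOSE for the flipped pairing `β'(y, x) = β(x, y)` (`Full.reversal_cup`: the front face of
  a reversed tuple is the reversed back face);

so for ordered cocycles `a, b`, with `c := ext a ∪ ext b = ext (a ∪ b) + d w` and `ext b ∪' ext a = ext (b ∪' a) + d w'` (the cup
defects are full coboundaries by Leray, ★ `Full.exists_d_eq_of_res_eq_sysD`), applying `R` and then ★ `Full.res` gives
§5 `a ∪ b − (-1)^{pq} • b ∪' a = d η` (`ε_{p+q} ε_p ε_q = (-1)^{pq}`), explicitly, and §6 on classes: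
**`cupH_comm`: `x ⌣_β y = (-1)^{pq} • y ⌣_{β'} x`** in `Ȟ^{p+q}` of the system of sections of an affine-localizing module on a finite
cover with affine finite intersections; `mulPairing_comm` makes `β = β' = mulPairing` (the structure sheaf) an instance.
The reversal operator is CHARACTERISED (a hypothesis `hR : R m c α = c(α ∘ Fin.rev)|`) in §2–§5 and instantiated by
`LinearMap.pi` in §6 — no definition is introduced.

## References
* J.-P. Serre, *Faisceaux algébriques cohérents*, Ann. of Math. 61 (1955), n° 20. [folklore]
* R. Godement, *Topologie algébrique et théorie des faisceaux* (1958), II §6.6 (cup product; anticommutativity on cohomology). [Godement1958]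
* The Stacks Project, Tags 01FG, 01FM (full vs ordered Čech complex), 01FP (cup product, graded commutativity). [StacksProject]
* U. Görtz, T. Wedhorn, *Algebraic Geometry II* (2023), (21.29), Thm. 22.9 (p. 236). [GortzWedhorn2023]
-/

universe v u

open CategoryTheory CategoryTheory.Limits HomologicalComplex AlgebraicGeometry TopologicalSpace

set_option backward.isDefEq.respectTransparency false -- `ModuleCat`-valued functors (as in ★ `OrderedCechSystem`)

noncomputable section

namespace Literature.Algebra.Homology

namespace OrderedCech

variable {ι : Type} [LinearOrder ι] {A : Type u} [CommRing A]

/-! ## §1 The sign of the order reversal `ε_m = ∏_{i ≤ m} (-1)^i` -/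

section Signs

/-- The reversal of `m + 1` positions inverts every pair: `inv rev = #{p < q} = Σ_q q`. [cite: StacksProject, Tag 01FG] -/
theorem inv_rev_eq_sum (m : ℕ) : inv (Fin.rev : Fin (m + 1) → Fin (m + 1)) = ∑ q : Fin (m + 1), (q : ℕ) := by
  classical
  unfold inv
  have hfilter : (Finset.univ.filter fun pq : Fin (m + 1) × Fin (m + 1) => pq.1 < pq.2 ∧ Fin.rev pq.2 < Fin.rev pq.1) =
      Finset.univ.filter fun pq : Fin (m + 1) × Fin (m + 1) => pq.1 < pq.2 := by
    ext ⟨p, q⟩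
    simp only [Finset.mem_filter, Finset.mem_univ, true_and, Fin.rev_lt_rev, and_self]
  rw [hfilter, Finset.card_eq_sum_card_fiberwise (f := Prod.snd) (t := Finset.univ) fun _ _ => Finset.mem_univ _]
  refine Finset.sum_congr rfl fun q _ => ?_
  have hfib : (Finset.univ.filter fun pq : Fin (m + 1) × Fin (m + 1) => pq.1 < pq.2).filter (fun pq => pq.2 = q) =
      (Finset.Iio q).image fun p => (p, q) := by
    ext ⟨p, q'⟩
    simp only [Finset.mem_filter, Finset.mem_univ, true_and, Finset.mem_image, Finset.mem_Iio, Prod.mk.injEq]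
    constructor
    · rintro ⟨hpq, rfl⟩
      exact ⟨p, hpq, rfl, rfl⟩
    · rintro ⟨p', hp', rfl, rfl⟩
      exact ⟨hp', rfl⟩
  rw [hfib, Finset.card_image_of_injective _ fun a b hab => (Prod.mk.inj hab).1, Fin.card_Iio]

/-- **The sign of the order reversal**: `(-1)^{inv rev} = ∏_{i ≤ m} (-1)^i` (`= (-1)^{m(m+1)/2}`). [cite: StacksProject, Tag 01FG] -/
theorem neg_one_pow_inv_rev (m : ℕ) :
    (-1 : A) ^ inv (Fin.rev : Fin (m + 1) → Fin (m + 1)) = ∏ i : Fin (m + 1), (-1 : A) ^ (i : ℕ) := by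
  rw [inv_rev_eq_sum, Finset.prod_pow_eq_pow_sum]

/-- The sign of the reversal permutation `Fin.revPerm` is `∏_{i ≤ m} (-1)^i`. [cite: StacksProject, Tag 01FG] -/
theorem sign_revPerm_eq_prod (m : ℕ) :
    ((Equiv.Perm.sign (Fin.revPerm : Equiv.Perm (Fin (m + 1))) : ℤ) : A) = ∏ i : Fin (m + 1), (-1 : A) ^ (i : ℕ) := by
  rw [← neg_one_pow_inv_perm, show (⇑(Fin.revPerm : Equiv.Perm (Fin (m + 1))) : Fin (m + 1) → Fin (m + 1)) = Fin.rev from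
    funext Fin.revPerm_apply, neg_one_pow_inv_rev]

/-- `ε_m² = 1`. [folklore] -/
private theorem prod_neg_one_pow_mul_self (m : ℕ) :
    (∏ i : Fin (m + 1), (-1 : A) ^ (i : ℕ)) * ∏ i : Fin (m + 1), (-1 : A) ^ (i : ℕ) = 1 := by
  rw [← Finset.prod_mul_distrib]
  exact Finset.prod_eq_one fun i _ => by rw [← pow_add, ← two_mul, pow_mul, neg_one_sq, one_pow]

/-- `ε_{m+1} = ε_m · (-1)^{m+1}`. [folklore] -/
private theorem prod_neg_one_pow_succ (m : ℕ) :
    ∏ i : Fin (m + 2), (-1 : A) ^ (i : ℕ) = (∏ i : Fin (m + 1), (-1 : A) ^ (i : ℕ)) * (-1) ^ (m + 1) := by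
  rw [Fin.prod_univ_castSucc]
  simp only [Fin.val_castSucc, Fin.val_last]

/-- **`ε_{p+q} ε_p ε_q = (-1)^{pq}`** — the sign of graded commutativity. [cite: StacksProject, Tag 01FP] -/
theorem prod_neg_one_pow_add_mul (p q n : ℕ) (h : p + q = n) :
    (∏ i : Fin (n + 1), (-1 : A) ^ (i : ℕ)) * (∏ i : Fin (p + 1), (-1 : A) ^ (i : ℕ)) *
        (∏ i : Fin (q + 1), (-1 : A) ^ (i : ℕ)) = (-1) ^ (p * q) := by
  subst h
  induction q with
  | zero =>
    rw [Fin.prod_univ_one, Fin.val_zero, pow_zero, mul_one, mul_zero, pow_zero]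
    exact prod_neg_one_pow_mul_self p
  | succ q ih =>
    rw [show p + (q + 1) = p + q + 1 from rfl, prod_neg_one_pow_succ (p + q), prod_neg_one_pow_succ q]
    calc (∏ i : Fin (p + q + 1), (-1 : A) ^ (i : ℕ)) * (-1) ^ (p + q + 1) * (∏ i : Fin (p + 1), (-1 : A) ^ (i : ℕ)) *
          ((∏ i : Fin (q + 1), (-1 : A) ^ (i : ℕ)) * (-1) ^ (q + 1))
        = (∏ i : Fin (p + q + 1), (-1 : A) ^ (i : ℕ)) * (∏ i : Fin (p + 1), (-1 : A) ^ (i : ℕ)) *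
            (∏ i : Fin (q + 1), (-1 : A) ^ (i : ℕ)) * ((-1) ^ (p + q + 1) * (-1) ^ (q + 1)) := by ring
      _ = (-1) ^ (p * q) * (-1) ^ p := by
          rw [ih, ← pow_add, neg_one_pow_eq_pow_mod_two (R := A) (n := p + q + 1 + (q + 1)),
            show (p + q + 1 + (q + 1)) % 2 = p % 2 by omega, ← neg_one_pow_eq_pow_mod_two (R := A)]
      _ = (-1) ^ (p * (q + 1)) := by rw [mul_add, mul_one, pow_add]

end Signs

namespace Full

/-! ## §2 The order reversal of the full complex (characterised) fixes alternating cochains up to `ε_m` -/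

section Reversal

variable {M : Finset ι ⥤ ModuleCat.{v} A}

omit [LinearOrder ι] in
/-- Reversing positions commutes with deleting one: `rev ∘ δ_{rev j} = δ_j ∘ rev` on tuples. [cite: StacksProject, Tag 01FG] -/
theorem comp_rev_comp_succAbove {m : ℕ} (γ : Fin (m + 2) → ι) (j : Fin (m + 2)) :
    (γ ∘ Fin.rev) ∘ Fin.succAbove (Fin.rev j) = (γ ∘ Fin.succAbove j) ∘ Fin.rev := by
  funext i
  simp only [Function.comp_apply]
  rw [Fin.rev_succAbove, Fin.rev_rev]

omit [LinearOrder ι] in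
/-- The front face of a reversed tuple is the reversed back face. [cite: StacksProject, Tag 01FP] -/
theorem front_comp_rev {p q n : ℕ} (h : p + q = n) (h' : q + p = n) (α : Fin (n + 1) → ι) :
    front p q n h (α ∘ Fin.rev) = back q p n h' α ∘ Fin.rev := by
  funext i
  simp only [Function.comp_apply, front_apply, back_apply]
  congr 1
  ext
  simp only [Fin.val_rev]
  omega

omit [LinearOrder ι] in
/-- The back face of a reversed tuple is the reversed front face. [cite: StacksProject, Tag 01FP] -/
theorem back_comp_rev {p q n : ℕ} (h : p + q = n) (h' : q + p = n) (α : Fin (n + 1) → ι) :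
    back p q n h (α ∘ Fin.rev) = front q p n h' α ∘ Fin.rev := by
  funext i
  simp only [Function.comp_apply, front_apply, back_apply]
  congr 1
  ext
  simp only [Fin.val_rev]
  omega

variable (M) in
/-- **The alternating extension evaluated on a reversed tuple**: `(ext g)(α ∘ rev)| = ε_m • (ext g)(α)` — the alternating rule
★ `SysCochain.altEvalAt_comp_perm` at the reversal permutation, whose sign is `ε_m = ∏_{i ≤ m} (-1)^i`. [cite: StacksProject, Tag 01FG] -/
theorem map_ext_comp_rev (m : ℕ) (g : SysCochain M m) (α : Fin (m + 1) → ι) :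
    (M.map (homOfLE (image_comp_subset α Fin.rev))).hom (ext M m g (α ∘ Fin.rev)) =
      (∏ i : Fin (m + 1), (-1 : A) ^ (i : ℕ)) • ext M m g α := by
  rw [ext_apply, ext_apply, SysCochain.map_altEvalAt g _ _ _ subset_rfl,
    show (Fin.rev : Fin (m + 1) → Fin (m + 1)) = ⇑(Fin.revPerm : Equiv.Perm (Fin (m + 1))) from
      (funext Fin.revPerm_apply).symm, SysCochain.altEvalAt_comp_perm, sign_revPerm_eq_prod]

variable (R : ∀ m : ℕ, Cochain M m →ₗ[A] Cochain M m)
  (hR : ∀ (m : ℕ) (c : Cochain M m) (α : Fin (m + 1) → ι),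
    R m c α = (M.map (homOfLE (image_comp_subset α Fin.rev))).hom (c (α ∘ Fin.rev)))

include hR in
/-- **The reversal fixes alternating cochains up to its sign**: `R (ext g) = ε_m • ext g` for an order reversal `R` of the full
complex (CHARACTERISED by `(R c)(α) = c(α ∘ rev)|`). [cite: StacksProject, Tag 01FG] -/
theorem reversal_ext (m : ℕ) (g : SysCochain M m) :
    R m (ext M m g) = (∏ i : Fin (m + 1), (-1 : A) ^ (i : ℕ)) • ext M m g := by
  funext α
  rw [hR, Pi.smul_apply]
  exact map_ext_comp_rev M m g α

/-! ## §3 The order reversal anti-commutes with the full differential up to `(-1)^{m+1}` -/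

include hR in
/-- **`d (R c) = (-1)^{m+1} • R (d c)`** for the full Čech differential `d = Σ_j (-1)^j δ_j^*`: deleting position `j` from a reversed
`(m+2)`-tuple deletes position `rev j = m + 1 - j` from the tuple (`comp_rev_comp_succAbove`), and `(-1)^{m+1-j} = (-1)^{m+1} (-1)^j`.
[cite: StacksProject, Tag 01FG] -/
theorem d_reversal (m : ℕ) (c : Cochain M m) :
    ((complex M).d m (m + 1)).hom (R m c) = ((-1 : A) ^ (m + 1)) • R (m + 1) (((complex M).d m (m + 1)).hom c) := by
  classical
  funext γ
  rw [complex_d_apply, Pi.smul_apply, hR, complex_d_apply, map_sum, Finset.smul_sum]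
  refine Fintype.sum_equiv (Fin.revPerm : Equiv.Perm (Fin (m + 2))) _ _ fun j => ?_
  rw [Fin.revPerm_apply, hR, map_map_apply, neg_one_pow_zsmul (A := A), map_zsmul, neg_one_pow_zsmul (A := A),
    map_map_apply, smul_smul]
  -- signs `(-1)^j = (-1)^{m+1} (-1)^{rev j}` and tuples `(γ ∘ δ_j) ∘ rev = (γ ∘ rev) ∘ δ_{rev j}`
  have hsign : ((-1 : A) ^ (m + 1)) * (-1) ^ ((Fin.rev j : Fin (m + 2)) : ℕ) = (-1) ^ (j : ℕ) := by
    rw [← pow_add, neg_one_pow_eq_pow_mod_two (R := A), Fin.val_rev,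
      show (m + 1 + (m + 2 - (↑j + 1))) % 2 = (j : ℕ) % 2 by have := j.2; omega, ← neg_one_pow_eq_pow_mod_two (R := A)]
  rw [hsign]
  congr 1
  exact map_apply_congr c (comp_rev_comp_succAbove γ j).symm _ _

end Reversal

/-! ## §4 The order reversal turns the position cup product into the flipped one, on the nose -/

section ReversalCup

variable {M N P : Finset ι ⥤ ModuleCat.{v} A} (β : ∀ s : Finset ι, M.obj s →ₗ[A] N.obj s →ₗ[A] P.obj s)
  (β' : ∀ s : Finset ι, N.obj s →ₗ[A] M.obj s →ₗ[A] P.obj s)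
  (RM : ∀ m : ℕ, Cochain M m →ₗ[A] Cochain M m)
  (hRM : ∀ (m : ℕ) (c : Cochain M m) (α : Fin (m + 1) → ι),
    RM m c α = (M.map (homOfLE (image_comp_subset α Fin.rev))).hom (c (α ∘ Fin.rev)))
  (RN : ∀ m : ℕ, Cochain N m →ₗ[A] Cochain N m)
  (hRN : ∀ (m : ℕ) (c : Cochain N m) (α : Fin (m + 1) → ι),
    RN m c α = (N.map (homOfLE (image_comp_subset α Fin.rev))).hom (c (α ∘ Fin.rev)))
  (RP : ∀ m : ℕ, Cochain P m →ₗ[A] Cochain P m)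
  (hRP : ∀ (m : ℕ) (c : Cochain P m) (α : Fin (m + 1) → ι),
    RP m c α = (P.map (homOfLE (image_comp_subset α Fin.rev))).hom (c (α ∘ Fin.rev)))

include hRM hRN hRP in
/-- **`R (x ∪_β y) = (R y) ∪_{β'} (R x)` on full cochains** for a natural pairing `β : M × N → P` and its flip
`β'(y, x) = β(x, y)`: the front `q`-face of `(α_n, …, α_0)` is the reversed back `q`-face of `α`, and symmetrically — the
position (Alexander–Whitney) cup product needs no order on the index set, so no sign appears here. [cite: StacksProject, Tag 01FP]
[cite: Godement1958, II §6.6] -/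
theorem reversal_cup (hβ : IsNaturalPairing β) (hflip : ∀ (s : Finset ι) (x : M.obj s) (y : N.obj s), β s x y = β' s y x)
    {p q n : ℕ} (h : p + q = n) (x : Cochain M p) (y : Cochain N q) :
    RP n (cup β p q n h x y) = cup β' q p n (by omega) (RN q y) (RM p x) := by
  funext α
  rw [hRP, cup_apply, hβ, map_map_apply, map_map_apply, hflip, cup_apply, hRN, hRM, map_map_apply, map_map_apply]
  exact congrArg₂ (fun u v => β' (Finset.univ.image α) u v)
    (map_apply_congr y (back_comp_rev h (by omega) α) _ _) (map_apply_congr x (front_comp_rev h (by omega) α) _ _)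

end ReversalCup

/-! ## §5 Graded commutativity of the ordered cup product, modulo Leray (pure algebra) -/

section Assembly

variable {M N P : Finset ι ⥤ ModuleCat.{v} A} (β : ∀ s : Finset ι, M.obj s →ₗ[A] N.obj s →ₗ[A] P.obj s)
  (β' : ∀ s : Finset ι, N.obj s →ₗ[A] M.obj s →ₗ[A] P.obj s)

/-- **Degree `0`: the ordered cup product is commutative ON COCHAINS** (`(a ∪ b)_{i} = β(a_i, b_i) = β'(b_i, a_i)`).
[cite: Godement1958, II §6.6] -/
theorem cup_comm_zero (hflip : ∀ (s : Finset ι) (x : M.obj s) (y : N.obj s), β s x y = β' s y x)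
    (a : SysCochain M (0 : ℕ)) (b : SysCochain N (0 : ℕ)) :
    OrderedCech.cup β (0 : ℕ) (0 : ℕ) (0 : ℕ) a b = OrderedCech.cup β' (0 : ℕ) (0 : ℕ) (0 : ℕ) b a := by
  funext σ
  rw [OrderedCech.cup_apply, OrderedCech.cup_apply]
  refine Finset.sum_congr rfl fun v hv => ?_
  have hσ : σ.1 = {v} := by
    obtain ⟨i, hi⟩ := Finset.card_eq_one.1 (by have := σ.2.2; omega : σ.1.card = 1)
    rw [hi] at hv ⊢
    rw [Finset.mem_singleton.1 hv]
  have hle : σ.1.filter (· ≤ v) = σ.1 :=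
    Finset.filter_eq_self.2 fun x hx => by rw [hσ] at hx; exact (Finset.mem_singleton.1 hx).le
  have hge : σ.1.filter (v ≤ ·) = σ.1 :=
    Finset.filter_eq_self.2 fun x hx => by rw [hσ] at hx; exact (Finset.mem_singleton.1 hx).ge
  rw [hle, hge, hflip]

variable (RM : ∀ m : ℕ, Cochain M m →ₗ[A] Cochain M m)
  (hRM : ∀ (m : ℕ) (c : Cochain M m) (α : Fin (m + 1) → ι),
    RM m c α = (M.map (homOfLE (image_comp_subset α Fin.rev))).hom (c (α ∘ Fin.rev)))
  (RN : ∀ m : ℕ, Cochain N m →ₗ[A] Cochain N m)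
  (hRN : ∀ (m : ℕ) (c : Cochain N m) (α : Fin (m + 1) → ι),
    RN m c α = (N.map (homOfLE (image_comp_subset α Fin.rev))).hom (c (α ∘ Fin.rev)))
  (RP : ∀ m : ℕ, Cochain P m →ₗ[A] Cochain P m)
  (hRP : ∀ (m : ℕ) (c : Cochain P m) (α : Fin (m + 1) → ι),
    RP m c α = (P.map (homOfLE (image_comp_subset α Fin.rev))).hom (c (α ∘ Fin.rev)))

include hRM hRN hRP in
/-- **Graded commutativity modulo Leray, explicitly.**  Let `β : M × N → P` be a natural pairing with flip `β'`, `a ∈ Čᵖ(M)`,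
`b ∈ Čᵠ(N)` ordered cochains (`p + q = m + 1`), and suppose the two cup defects of the alternating extensions are full coboundaries:
`ext a ∪_F ext b − ext (a ∪ b) = d w`, `ext b ∪'_F ext a − ext (b ∪' a) = d w'`.  Then
`a ∪ b − (-1)^{pq} • b ∪' a = d ((-1)^{pq} • res w' − ε_{m+1} (-1)^{m+1} • res (R w))` — apply the order reversal `R` to
`ext a ∪_F ext b` (`reversal_cup`, `reversal_ext`, `d_reversal`), restrict to increasing tuples (★ `res_ext`, ★ `sysD_res`) and use
`ε_{p+q} ε_p ε_q = (-1)^{pq}`. [cite: Godement1958, II §6.6] [cite: StacksProject, Tag 01FP] -/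
theorem cup_sub_smul_cup_eq_sysD_of (hβ : IsNaturalPairing β)
    (hflip : ∀ (s : Finset ι) (x : M.obj s) (y : N.obj s), β s x y = β' s y x)
    {p q m : ℕ} (h : p + q = m + 1) (a : SysCochain M p) (b : SysCochain N q) (w : Cochain P m)
    (hw : ((complex P).d m (m + 1)).hom w =
      cup β p q (m + 1) h (ext M p a) (ext N q b) - ext P (m + 1) (OrderedCech.cup β p q ((m + 1 : ℕ) : ℤ) a b))
    (w' : Cochain P m)
    (hw' : ((complex P).d m (m + 1)).hom w' =
      cup β' q p (m + 1) (by omega) (ext N q b) (ext M p a) - ext P (m + 1) (OrderedCech.cup β' q p ((m + 1 : ℕ) : ℤ) b a)) :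
    OrderedCech.cup β p q ((m + 1 : ℕ) : ℤ) a b - ((-1 : A) ^ (p * q)) • OrderedCech.cup β' q p ((m + 1 : ℕ) : ℤ) b a =
      sysD P m (((-1 : A) ^ (p * q)) • res P m w' -
        ((∏ i : Fin (m + 1 + 1), (-1 : A) ^ (i : ℕ)) * (-1) ^ (m + 1)) • res P m (RP m w)) := by
  have hNN : (∏ i : Fin (m + 1 + 1), (-1 : A) ^ (i : ℕ)) * ∏ i : Fin (m + 1 + 1), (-1 : A) ^ (i : ℕ) = 1 :=
    prod_neg_one_pow_mul_self (m + 1)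
  have hsign : (∏ i : Fin (m + 1 + 1), (-1 : A) ^ (i : ℕ)) *
      ((∏ i : Fin (q + 1), (-1 : A) ^ (i : ℕ)) * ∏ i : Fin (p + 1), (-1 : A) ^ (i : ℕ)) = (-1) ^ (p * q) := by
    rw [← prod_neg_one_pow_add_mul p q (m + 1) h, mul_comm (∏ i : Fin (q + 1), (-1 : A) ^ (i : ℕ)), ← mul_assoc]
  -- the reversal of a full coboundary: `R (d w) = (-1)^{m+1} • d (R w)`
  have hRd : RP (m + 1) (((complex P).d m (m + 1)).hom w) =
      ((-1 : A) ^ (m + 1)) • ((complex P).d m (m + 1)).hom (RP m w) := by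
    rw [d_reversal RP hRP, smul_smul, ← pow_add, ← two_mul, pow_mul, neg_one_sq, one_pow, one_smul]
  -- `R (ext a ∪_F ext b) = ε_q ε_p • (ext b ∪'_F ext a)`
  have hRc : RP (m + 1) (cup β p q (m + 1) h (ext M p a) (ext N q b)) =
      ((∏ i : Fin (q + 1), (-1 : A) ^ (i : ℕ)) * ∏ i : Fin (p + 1), (-1 : A) ^ (i : ℕ)) •
        cup β' q p (m + 1) (by omega) (ext N q b) (ext M p a) := by
    rw [reversal_cup β β' RM hRM RN hRN RP hRP hβ hflip h, reversal_ext RN hRN, reversal_ext RM hRM,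
      LinearMap.map_smul₂, map_smul, smul_smul]
  -- apply `res ∘ R` to `hw`, `res` to `hw'`
  have key := congrArg (fun v => res P (m + 1) (RP (m + 1) v)) hw
  rw [hRd, map_sub, hRc, reversal_ext RP hRP, map_smul, ← sysD_res, map_sub, map_smul, map_smul, res_ext,
    eq_sub_iff_add_eq] at key
  have key' := congrArg (res P (m + 1)) hw'
  rw [← sysD_res, map_sub, res_ext, eq_sub_iff_add_eq] at key'
  rw [← key'] at key
  -- multiply by `ε_{m+1}` (`ε² = 1`, `ε_{p+q} ε_q ε_p = (-1)^{pq}`)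
  have h2 := congrArg (fun v => (∏ i : Fin (m + 1 + 1), (-1 : A) ^ (i : ℕ)) • v) key
  simp only [smul_add, smul_smul, hNN, one_smul, hsign] at h2
  rw [map_sub, map_smul, map_smul, sub_eq_sub_iff_add_eq_add]
  exact (add_comm _ _).trans h2

end Assembly

end Full

end OrderedCech

end Literature.Algebra.Homology

/-! ## §6 Graded commutativity on classes for systems of sections (Leray) -/

namespace Literature.AlgebraicGeometry.Modules

open Literature.Algebra.Homology Literature.Algebra.Homology.OrderedCech

variable {X : Scheme.{0}} {ι : Type} [LinearOrder ι] [Fintype ι] (U : ι → X.Opens) (L : X.Modules)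
  {A : Type} [CommRing A] (ρ : A →+* Γ(X, ⊤))
  {M N : Finset ι ⥤ ModuleCat.{0} A}
  (β : ∀ s : Finset ι, M.obj s →ₗ[A] N.obj s →ₗ[A] (sectionsSystem U L ρ).obj s)
  (β' : ∀ s : Finset ι, N.obj s →ₗ[A] M.obj s →ₗ[A] (sectionsSystem U L ρ).obj s)

/-- **The graded commutator of two ordered cup products of cocycles is an ordered coboundary** when the target system is the system
of sections `(Γ(L, U_s))_s` of an affine-localizing `𝒪_X`-module on a finite cover with affine finite intersections: for ordered
cocycles `a ∈ Čᵖ(M)`, `b ∈ Čᵠ(N)` with `p + q = m + 1` and a natural pairing `β : M × N → Γ(L, U_•)` with flip `β'`,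
`a ∪_β b − (-1)^{pq} • b ∪_{β'} a = d η` (the two cup defects are full coboundaries by Leray, ★ `Full.exists_d_eq_of_res_eq_sysD`; then
`Full.cup_sub_smul_cup_eq_sysD_of` with the order reversal instantiated). [cite: Godement1958, II §6.6] [cite: StacksProject, Tag 01FM]
[cite: GortzWedhorn2023, Thm. 22.9 (p. 236)] -/
theorem cup_sub_smul_cup_eq_sysD (hUa : ∀ s : Finset ι, s.Nonempty → IsAffineOpen (cechOpen U s))
    (hcov : ⨆ i, U i = ⊤) (hL : IsAffineLocalizing L) (hβ : IsNaturalPairing β) (hβ' : IsNaturalPairing β')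
    (hflip : ∀ (s : Finset ι) (x : M.obj s) (y : N.obj s), β s x y = β' s y x)
    {p q m : ℕ} (h : p + q = m + 1) (a : SysCochain M p) (b : SysCochain N q)
    (ha : sysD M p a = 0) (hb : sysD N q b = 0) :
    ∃ η : SysCochain (sectionsSystem U L ρ) m,
      OrderedCech.cup β p q ((m + 1 : ℕ) : ℤ) a b - ((-1 : A) ^ (p * q)) • OrderedCech.cup β' q p ((m + 1 : ℕ) : ℤ) b a =
        sysD (sectionsSystem U L ρ) m η := by
  obtain ⟨w, hw⟩ := Full.exists_d_eq_of_res_eq_sysD U L ρ hUa hcov hL m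
    (Full.cup β p q (m + 1) h (Full.ext M p a) (Full.ext N q b) -
      Full.ext _ (m + 1) (OrderedCech.cup β p q ((m + 1 : ℕ) : ℤ) a b))
    (Full.d_cupDefect hβ h a b ha hb) 0 (by rw [Full.res_cupDefect hβ h a b, map_zero])
  obtain ⟨w', hw'⟩ := Full.exists_d_eq_of_res_eq_sysD U L ρ hUa hcov hL m
    (Full.cup β' q p (m + 1) (by omega) (Full.ext N q b) (Full.ext M p a) -
      Full.ext _ (m + 1) (OrderedCech.cup β' q p ((m + 1 : ℕ) : ℤ) b a))
    (Full.d_cupDefect hβ' (by omega) b a hb ha) 0 (by rw [Full.res_cupDefect hβ' (by omega) b a, map_zero])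
  exact ⟨_, Full.cup_sub_smul_cup_eq_sysD_of β β'
    (fun m => LinearMap.pi fun α =>
      (M.map (homOfLE (Full.image_comp_subset α Fin.rev))).hom ∘ₗ LinearMap.proj (α ∘ Fin.rev))
    (fun _ _ _ => rfl)
    (fun m => LinearMap.pi fun α =>
      (N.map (homOfLE (Full.image_comp_subset α Fin.rev))).hom ∘ₗ LinearMap.proj (α ∘ Fin.rev))
    (fun _ _ _ => rfl)
    (fun m => LinearMap.pi fun α =>
      ((sectionsSystem U L ρ).map (homOfLE (Full.image_comp_subset α Fin.rev))).hom ∘ₗ LinearMap.proj (α ∘ Fin.rev))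
    (fun _ _ _ => rfl) hβ hflip h a b w hw w' hw'⟩

/-- **THE CUP PRODUCT ON ORDERED ČECH COHOMOLOGY IS GRADED COMMUTATIVE.**  Let `𝓤` be a finite cover of the scheme `X` with
affine finite intersections, `L` an affine-localizing `𝒪_X`-module, `S := (Γ(L, U_s))_s` its system of sections, and `β : M × N → S`
a natural pairing of coefficient systems with flip `β' : N × M → S` (`β'(y, x) = β(x, y)`).  Then for classes `x ∈ Ȟᵖ(M)`,
`y ∈ Ȟᵠ(N)` of the ordered complexes and `p + q = n`:  `x ⌣_β y = (-1)^{pq} • (y ⌣_{β'} x)` in `Ȟⁿ(𝓤, L)` (class-level cup ★ `cupH`).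
With `M = N = S = 𝒪` and `β = β' = mulPairing` (`mulPairing_comm`): the cohomology ring `Ȟ•(𝓤, 𝒪_X)` is graded commutative.
[cite: Godement1958, II §6.6] [cite: StacksProject, Tag 01FP] [cite: StacksProject, Tag 01FM] [cite: GortzWedhorn2023, Thm. 22.9 (p. 236)] -/
theorem cupH_comm (hUa : ∀ s : Finset ι, s.Nonempty → IsAffineOpen (cechOpen U s))
    (hcov : ⨆ i, U i = ⊤) (hL : IsAffineLocalizing L) (hβ : IsNaturalPairing β) (hβ' : IsNaturalPairing β')
    (hflip : ∀ (s : Finset ι) (x : M.obj s) (y : N.obj s), β s x y = β' s y x)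
    (p q n : ℕ) (h : p + q = n) (x : (sysComplex M).homology (p : ℤ)) (y : (sysComplex N).homology (q : ℤ)) :
    cupH β hβ p q n h x y = ((-1 : A) ^ (p * q)) • cupH β' hβ' q p n (by omega) y x := by
  obtain ⟨z, rfl⟩ := homologyπ_surjective (sysComplex M) p x
  obtain ⟨w, rfl⟩ := homologyπ_surjective (sysComplex N) q y
  rw [cupH_π, cupH_π, ← map_smul]
  -- the two underlying cochains are cocycles `a`, `b`
  set a : SysCochain M p := ((sysComplex M).iCycles p).hom z with ha_def
  set b : SysCochain N q := ((sysComplex N).iCycles q).hom w with hb_def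
  have ha : sysD M p a = 0 := by
    have := congrArg (fun f => f.hom z) ((sysComplex M).iCycles_d (p : ℤ) (p + 1))
    rw [sysComplex_d] at this
    exact this
  have hb : sysD N q b = 0 := by
    have := congrArg (fun f => f.hom w) ((sysComplex N).iCycles_d (q : ℤ) (q + 1))
    rw [sysComplex_d] at this
    exact this
  rcases Nat.eq_zero_or_eq_succ_pred n with hn | hn
  · -- degree `0`: commutative on cochains
    subst hn
    have hp0 : p = 0 := by omega
    have hq0 : q = 0 := by omega
    subst hp0
    subst hq0
    rw [mul_zero, pow_zero, one_smul]
    congr 1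
    apply cycles_ext
    rw [iCycles_cupCycles β hβ 0 0 0 h, iCycles_cupCycles β' hβ' 0 0 0 h]
    exact Full.cup_comm_zero β β' hflip a b
  · obtain ⟨m, rfl⟩ : ∃ m, n = m + 1 := ⟨n.pred, hn⟩
    obtain ⟨η, hη⟩ := cup_sub_smul_cup_eq_sysD U L ρ β β' hUa hcov hL hβ hβ' hflip h a b ha hb
    refine homologyπ_eq_of_sub_eq_d (sysComplex (sectionsSystem U L ρ)) _ _ (i' := (m : ℤ)) η ?_
    rw [map_smul, iCycles_cupCycles β hβ p q (m + 1) h, iCycles_cupCycles β' hβ' q p (m + 1) (by omega), hη]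
    have hd : (sysComplex (sectionsSystem U L ρ)).d (m : ℤ) ((m + 1 : ℕ) : ℤ) =
        ModuleCat.ofHom (sysD (sectionsSystem U L ρ) m) := sysComplex_d _ m
    rw [hd]
    rfl

/-- **The ordered Čech cohomology ring `Ȟ•(𝓤, 𝒪_X)` is graded commutative**: `x ⌣ y = (-1)^{pq} • y ⌣ x` for the cup product
of ★ `mulPairing` (★ `mulPairing_comm`; finite cover with affine finite intersections) — the `hcomm` input of ★ `cup_one_one_surjective` (F-J3b).
[cite: Godement1958, II §6.6] [cite: StacksProject, Tag 01FP] [cite: StacksProject, Tag 01FM] -/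
theorem cupH_mulPairing_comm (hUa : ∀ s : Finset ι, s.Nonempty → IsAffineOpen (cechOpen U s)) (hcov : ⨆ i, U i = ⊤)
    (p q n : ℕ) (h : p + q = n) (x : (cechComplex U (unitModule X) ρ).homology (p : ℤ))
    (y : (cechComplex U (unitModule X) ρ).homology (q : ℤ)) :
    cupH (mulPairing U ρ) (isNaturalPairing_mulPairing U ρ) p q n h x y =
      ((-1 : A) ^ (p * q)) • cupH (mulPairing U ρ) (isNaturalPairing_mulPairing U ρ) q p n (by omega) y x :=
  cupH_comm U (unitModule X) ρ (mulPairing U ρ) (mulPairing U ρ) hUa hcov IsAffineLocalizing.unit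
    (isNaturalPairing_mulPairing U ρ) (isNaturalPairing_mulPairing U ρ) (mulPairing_comm U ρ) p q n h x y

end Literature.AlgebraicGeometry.Modules

end
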